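import Mathlib
import Summits.PneNP.PneNP.Theorems.OverlapGapAlgebraNoStableSection
import Summits.PneNP.PneNP.Theorems.OverlapGapAlgebraSearchHardWindowMacroPath
import Summits.PneNP.PneNP.Theorems.OverlapGapAlgebraSearchHardWindowMacroCount

/-!
# Route OverlapGapAlgebra, crux `SearchHardWindow` (stmt-PneNP-2460): the MACRO-STEP
# `NoStableSection` — the OGP ceiling with checkpoints every `L` literals, uniformly in `L`

**Theorem (`macroNoStableSection`).** There is `k₀` such that for every `k ≥ k₀` there are
`η, ν, c > 0` (the witnesses of the `DartGame` proof of `NoStableSection`: `η = 1/k²`, `ν = 4^{-k}`,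
`c = log k/(2k)`) with: for all large `n`, `m = ⌊5·2^k log k/k · n⌋₊`, for EVERY block length `L ≥ 1`
and EVERY section `g : instances → assignments`, the path tuples `Ψ` (k+1 i.i.d. literal arrays) on
which `g` is `ν`-valid at every CHECKPOINT `q = i·L`, `i ≤ ⌈m/L⌉·k`, of every sweep of the
Bresler–Huang interpolation path and moves by `≤ η n` between CONSECUTIVE checkpoints number at most
`e^{-cn} · #paths`. At `L = 1` this is (a restatement of) the crux `NoStableSection` (stmt-PneNP-2462);
for `L > 1` the event is LARGER (fewer validity constraints, stability only across blocks of `L`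
resampled literals), yet the ceiling `e^{-cn}` and the threshold in `n` do not depend on `L`:
Bresler–Huang's ladder argument only ever reads the outputs at the times it selects
(`mns_ogpBad_of_macro`, `…MacroPath.lean`), and the two first moments do not involve `g`'s clock at
all (`mns_badCount_fixed_k`, `…MacroCount.lean`; parameters from `glue_KA` of the `DartGame` glue).

Use (this seat's line on stmt-PneNP-2460): against the block form of the scan correlation inequality
the success probability `p` of a low-degree map now pays only `p^{k·⌈m/L⌉·k + 1} ≈ p^{k²αn/L}`, so
`p → 0` (choose `L` large) instead of `p ≤ 1 − δ`. No definitions; no named facts.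

References: G. Bresler, B. Huang, FOCS 2021 / arXiv:2106.02129, Thm. 2.6, Props. 4.6–4.7, §5
[BreslerHuang2022]; B. Huang, M. Sellke, arXiv:2501.06427, §3.3 [HuangSellke2025].
-/

namespace Summit.PneNP.PneNP.Theorems

set_option linter.dupNamespace false -- `Summit.PneNP.PneNP.…`: summit = sub-problem (D-0017)

open Finset Filter Real
open Summit.PneNP.PneNP.Cruxes.NoStableSection.DartGame
open scoped Classical Topology

/-- **The macro-step `NoStableSection`.** See the module docstring: for `k ≥ k₀` there are
`η, ν, c > 0` such that for all large `n`, `m = ⌊5·2^k log k/k · n⌋₊`, every `L ≥ 1` and every section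
`g`, the path tuples on which `g` is `ν`-valid at all checkpoints `i·L`, `i ≤ ⌈m/L⌉·k`, of every sweep
and `η n`-stable between consecutive checkpoints number `≤ e^{-cn} · #paths` (`P r q` is the
splice point `(r, q)` exactly as in the crux `NoStableSection`; `⌈m/L⌉ = (m + L - 1)/L`).
[BreslerHuang2022, Thm. 2.6, Props. 4.6–4.7] -/
theorem macroNoStableSection :
    ∃ k₀ : ℕ, ∀ k ≥ k₀, ∃ η : ℝ, 0 < η ∧ ∃ ν : ℝ, 0 < ν ∧ ∃ c : ℝ, 0 < c ∧
      ∀ᶠ n : ℕ in Filter.atTop, ∀ m : ℕ, m = ⌊5 * 2 ^ k * Real.log k / k * n⌋₊ → ∀ L : ℕ, 1 ≤ L →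
        ∀ g : (Fin m → Fin k → Fin n × Bool) → (Fin n → Bool),
          ((Finset.univ.filter fun Ψ : Fin (k + 1) → Fin m → Fin k → Fin n × Bool =>
            let P : Fin k → ℕ → Fin m → Fin k → Fin n × Bool := fun r q a b =>
              if (a : ℕ) * k + b < q then Ψ r.succ a b else Ψ r.castSucc a b
            (∀ r : Fin k, ∀ i ≤ (m + L - 1) / L * k,
                ((Finset.univ.filter fun a : Fin m => ∀ j, g (P r (i * L)) (P r (i * L) a j).1 ≠
                  (P r (i * L) a j).2).card : ℝ) ≤ ν * m) ∧
              ∀ r : Fin k, ∀ i < (m + L - 1) / L * k,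
                (hammingDist (g (P r (i * L))) (g (P r ((i + 1) * L))) : ℝ) ≤ η * n).card : ℝ)
            ≤ Real.exp (-(c * n)) * Fintype.card (Fin (k + 1) → Fin m → Fin k → Fin n × Bool) := by
  obtain ⟨k₀, hk₀⟩ := Filter.eventually_atTop.1 glue_KA
  refine ⟨k₀, fun k hk => ?_⟩
  obtain ⟨h2k, hη2, hwin, hνk, hθ1, hθb, hD0, hI, hO⟩ := hk₀ k hk
  have hkr : (2 : ℝ) ≤ k := by exact_mod_cast h2k
  have hkpos : (0 : ℝ) < k := by linarith
  have hlogk : 0 < Real.log k := Real.log_pos (by linarith)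
  have hLr : 0 < Real.log k / k := div_pos hlogk hkpos
  have hη0 : (0 : ℝ) < 1 / (k : ℝ) ^ 2 := by positivity
  have hν0 : (0 : ℝ) < (1 / 4 : ℝ) ^ k := by positivity
  have hθ0 : (0 : ℝ) < 1 / ((k : ℝ) * (Real.log k) ^ 2) := by positivity
  have hbm : (0 : ℝ) < 2.6 * (Real.log k / k) := by positivity
  have hα : (0 : ℝ) < 5 * 2 ^ k * Real.log k / k := by positivity
  refine ⟨1 / (k : ℝ) ^ 2, hη0, (1 / 4 : ℝ) ^ k, hν0, Real.log k / k / 2, half_pos hLr, ?_⟩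
  have hmain := mns_badCount_fixed_k (k := k) stub_condEntCount stub_pathValidCount stub_indepCount
    stub_energyBound h2k hη0 hη2 hν0 hνk hwin hθ0 hθ1 hθb hLr hα hD0 hI hO
  -- `m ≥ 1` eventually
  have hm1 : ∀ᶠ n : ℕ in atTop, (1 : ℝ) ≤ 5 * 2 ^ k * Real.log k / k * n - 1 := by
    have ht : Tendsto (fun n : ℕ => 5 * 2 ^ k * Real.log k / k * n - 1) atTop atTop :=
      tendsto_atTop_add_const_right _ _ (Tendsto.const_mul_atTop hα tendsto_natCast_atTop_atTop)
    exact ht.eventually_ge_atTop _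
  filter_upwards [hmain, hm1] with n hn hn1 m hm L hL g
  have hm_ge : 5 * 2 ^ k * Real.log k / k * n - 1 ≤ m := by
    rw [hm]; exact (Nat.sub_one_lt_floor _).le
  have hmpos : 1 ≤ m := by
    have : (1 : ℝ) ≤ m := hn1.trans hm_ge
    exact_mod_cast this
  refine le_trans ?_ (hn m hm g)
  refine Nat.cast_le.2 (Finset.card_le_card fun Ψ hΨ => ?_)
  simp only [Finset.mem_filter, Finset.mem_univ, true_and] at hΨ ⊢
  by_cases hIB : IndepBad g ((1 / 4 : ℝ) ^ k) (2.7 * (Real.log k / k)) Ψ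
  · exact Or.inl hIB
  · refine Or.inr (mns_ogpBad_of_macro (by omega) hmpos hL hη0.le hη2 hbm.le hwin
      (fun r i hi => ?_) (fun r i hi => ?_) hIB)
    · exact hΨ.1 r i hi
    · exact hΨ.2 r i hi

end Summit.PneNP.PneNP.Theorems
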